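import Summits.SmoothPoincare4.SmoothPoincare4.Theorems.CongruenceShadowsHeegaardHandlebodyCongruenceClosedReduction

/-!
# Crux `CongruenceShadows.HeegaardHandlebodyCongruenceClosed` = (locus form) ∧ (no fine ghosts), unconditionally;
and the route's gate `ArtinGates.1` needs only the locus form
(item stmt-SmoothPoincare4-14596, line `pair-rigidity-retraction`; `--supports` the crux via the registered stubs
`stub_hhccIffLocusAndLimitsSimplyConnected`, `stub_artinGatesOfLocus`)

Notation as in `…Reduction.lean`: `S = SurfaceGroup (3+3m)`, `N = s4Kernels.stabilizeIter m = (N₀,N₁,N₂)`,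
`H = Stab N₀ ∩ Stab N₁`, `C = Stab N₂`, product-congruent `ρ` = the crux hypothesis, `J_ρ = N₀ ⊔ N₁ ⊔ ρN₂`.

Two forms of the crux:
* LOCUS form `HHCC|locus`: every product-congruent `ρ` WITH `J_ρ = ⊤` (the glued 4-manifold is simply connected) is a
  product `x ∘ c`, `x ∈ H`, `c ∈ C`;
* "no fine ghosts" `LSC`: every product-congruent `ρ` has `J_ρ = ⊤`.

Results (all unconditional unless an item is named as a hypothesis):
* `hhcc_iff_locus_and_limitsSimplyConnected` (= registered stub `stub_hhccIffLocusAndLimitsSimplyConnected`):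
  `HeegaardHandlebodyCongruenceClosed ↔ HHCC|locus ∧ LSC`.
* `shadowApproximation_of_congruenceApproximable_of_locus` (= registered stub `stub_artinGatesOfLocus`): the first
  conjunct of the route's support `ArtinGates` (stmt-14857: `CongruenceApproximable → HHCC → ShadowApproximation`)
  holds with `HHCC` weakened to `HHCC|locus` — the route's load path never uses the crux off the locus (the `ρ` produced
  by `CongruenceApproximable` re-glues a trisection of the trivial group, so `J_ρ = ⊤`).
* `not_hhcc_of_fineGhost`: one fine ghost (a product-congruent `ρ` with `J_ρ ≠ ⊤`, at any genus) refutes the crux.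

Together with `…Equivalence.lean` (`hhccOnLocus_of_items`: `HHCC|locus` from items 15157 ∧ 14595 ∧ 14592) this pins the
crux down: its load-bearing part `HHCC|locus` is equivalent to `ShadowApproximation` modulo (`CongruenceApproximable`,
`WaldhausenPairs`, `HeegaardPairFreenessDetection`), and its surplus over the locus form is exactly `LSC`, a
ghost-exclusion statement about homology 4-spheres with profinitely invisible `π₁` that no item of the route implies
and the route never uses.
-/

noncomputable section

-- the prescribed namespace `Summit.<P>.<Sub>.…` duplicates `SmoothPoincare4` (P = Sub)
set_option linter.dupNamespace false

namespace Summit.SmoothPoincare4.SmoothPoincare4.Theorems.HeegaardHandlebodyCongruenceClosed.PairRigidityRetraction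

open Literature.Topology.FourManifolds Subgroup
open Summit.SmoothPoincare4.SmoothPoincare4.Theses.CongruenceShadows
  (HeegaardHandlebodyCongruenceClosed ShadowApproximation CongruenceApproximable)

/-! ## The crux is (locus form) ∧ (no fine ghosts) -/

/-- **`HHCC ↔ HHCC|locus ∧ LSC`, unconditionally.**  The crux holds iff (i) every product-congruent `ρ` whose glued group
is trivial (`N₀ ⊔ N₁ ⊔ ρN₂ = ⊤`) is a product, and (ii) every product-congruent `ρ` has trivial glued group
(`→`: (i) by weakening, (ii) = `limitsSimplyConnected_of_hhcc`; `←`: compose). [folklore] -/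
theorem hhcc_iff_locus_and_limitsSimplyConnected :
    HeegaardHandlebodyCongruenceClosed ↔
      (∀ (m : ℕ) (ρ : SurfaceGroup (3 + 3 * m) ≃* SurfaceGroup (3 + 3 * m)),
        (∀ M : Subgroup (SurfaceGroup (3 + 3 * m)), M.Characteristic → M.FiniteIndex →
          ∃ x c : SurfaceGroup (3 + 3 * m) ≃* SurfaceGroup (3 + 3 * m),
            (s4Kernels.stabilizeIter m 0).map x.toMonoidHom = s4Kernels.stabilizeIter m 0 ∧
            (s4Kernels.stabilizeIter m 1).map x.toMonoidHom = s4Kernels.stabilizeIter m 1 ∧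
            (s4Kernels.stabilizeIter m 2).map c.toMonoidHom = s4Kernels.stabilizeIter m 2 ∧
            ∀ s, ρ s * (x (c s))⁻¹ ∈ M) →
        s4Kernels.stabilizeIter m 0 ⊔ s4Kernels.stabilizeIter m 1 ⊔
          (s4Kernels.stabilizeIter m 2).map ρ.toMonoidHom = ⊤ →
        ∃ x c : SurfaceGroup (3 + 3 * m) ≃* SurfaceGroup (3 + 3 * m),
          (s4Kernels.stabilizeIter m 0).map x.toMonoidHom = s4Kernels.stabilizeIter m 0 ∧
          (s4Kernels.stabilizeIter m 1).map x.toMonoidHom = s4Kernels.stabilizeIter m 1 ∧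
          (s4Kernels.stabilizeIter m 2).map c.toMonoidHom = s4Kernels.stabilizeIter m 2 ∧ ∀ s, ρ s = x (c s)) ∧
      (∀ (m : ℕ) (ρ : SurfaceGroup (3 + 3 * m) ≃* SurfaceGroup (3 + 3 * m)),
        (∀ M : Subgroup (SurfaceGroup (3 + 3 * m)), M.Characteristic → M.FiniteIndex →
          ∃ x c : SurfaceGroup (3 + 3 * m) ≃* SurfaceGroup (3 + 3 * m),
            (s4Kernels.stabilizeIter m 0).map x.toMonoidHom = s4Kernels.stabilizeIter m 0 ∧
            (s4Kernels.stabilizeIter m 1).map x.toMonoidHom = s4Kernels.stabilizeIter m 1 ∧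
            (s4Kernels.stabilizeIter m 2).map c.toMonoidHom = s4Kernels.stabilizeIter m 2 ∧
            ∀ s, ρ s * (x (c s))⁻¹ ∈ M) →
        s4Kernels.stabilizeIter m 0 ⊔ s4Kernels.stabilizeIter m 1 ⊔
          (s4Kernels.stabilizeIter m 2).map ρ.toMonoidHom = ⊤) :=
  ⟨fun hC => ⟨fun m ρ hρ _ => hC m ρ hρ, fun m ρ hρ => limitsSimplyConnected_of_hhcc hC m ρ hρ⟩,
    fun ⟨hL, hS⟩ m ρ hρ => hL m ρ hρ (hS m ρ hρ)⟩

/-- **One fine ghost refutes the crux.**  If at some genus `3+3m` some product-congruent `ρ` glues a non-simply-connected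
4-manifold (`N₀ ⊔ N₁ ⊔ ρN₂ ≠ ⊤`), then `HeegaardHandlebodyCongruenceClosed` fails (contrapositive of
`limitsSimplyConnected_of_hhcc`). [folklore] -/
theorem not_hhcc_of_fineGhost
    (h : ∃ (m : ℕ) (ρ : SurfaceGroup (3 + 3 * m) ≃* SurfaceGroup (3 + 3 * m)),
      (∀ M : Subgroup (SurfaceGroup (3 + 3 * m)), M.Characteristic → M.FiniteIndex →
        ∃ x c : SurfaceGroup (3 + 3 * m) ≃* SurfaceGroup (3 + 3 * m),
          (s4Kernels.stabilizeIter m 0).map x.toMonoidHom = s4Kernels.stabilizeIter m 0 ∧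
          (s4Kernels.stabilizeIter m 1).map x.toMonoidHom = s4Kernels.stabilizeIter m 1 ∧
          (s4Kernels.stabilizeIter m 2).map c.toMonoidHom = s4Kernels.stabilizeIter m 2 ∧
          ∀ s, ρ s * (x (c s))⁻¹ ∈ M) ∧
      s4Kernels.stabilizeIter m 0 ⊔ s4Kernels.stabilizeIter m 1 ⊔
        (s4Kernels.stabilizeIter m 2).map ρ.toMonoidHom ≠ ⊤) :
    ¬ HeegaardHandlebodyCongruenceClosed :=
  fun hC => by
    obtain ⟨m, ρ, hρ, hne⟩ := h
    exact hne (limitsSimplyConnected_of_hhcc hC m ρ hρ)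

/-! ## The route needs only the locus form: `ArtinGates.1` from `HHCC|locus` -/

/-- For a group trisection `K` of the trivial group, `K₀ ⊔ K₁ ⊔ K₂ = ⊤`. [folklore] -/
theorem sup_eq_top_of_isGroupTrisection_punit {m : ℕ} {K : TrisectionKernels (3 + 3 * m)}
    (hK : IsGroupTrisection (3 + 3 * m) (m + 1) (PUnit : Type) K) : K 0 ⊔ K 1 ⊔ K 2 = ⊤ := by
  obtain ⟨e⟩ := hK.triple
  haveI : Subsingleton K.tripleQuotient := e.toEquiv.subsingleton
  have hnc : normalClosure (⋃ i, (K i : Set (SurfaceGroup (3 + 3 * m)))) = ⊤ := by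
    rw [eq_top_iff]
    intro s _
    exact (QuotientGroup.eq_one_iff s).1 (Subsingleton.elim _ _)
  haveI := hK.normal 0
  haveI := hK.normal 1
  haveI := hK.normal 2
  rw [eq_top_iff, ← hnc]
  refine normalClosure_le_normal (Set.iUnion_subset fun i => ?_)
  fin_cases i
  · exact fun s hs => mem_sup_left (mem_sup_left hs)
  · exact fun s hs => mem_sup_left (mem_sup_right hs)
  · exact fun s hs => mem_sup_right hs

/-- **`ArtinGates.1` with the crux weakened to its locus form.**  `CongruenceApproximable` (stmt-14855) and
`HHCC|locus` imply `ShadowApproximation` (stmt-14595): for a normalised trisection `K` of `{1}` with standard shadows,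
14855 gives `α`, `ρ` with `αN₀ = K₀`, `αN₁ = K₁`, `αρN₂ = K₂` and `ρ` product-congruent; then
`α(N₀ ⊔ N₁ ⊔ ρN₂) = K₀ ⊔ K₁ ⊔ K₂ = ⊤`, so `ρ` lies ON the locus, `HHCC|locus` makes `ρ = x ∘ c`, and `α ∘ x` carries `N`
to `K` (as in `ArtinGates_proof`).  So the route's load path uses the crux only on the locus. [folklore] -/
theorem shadowApproximation_of_congruenceApproximable_of_locus (hCA : CongruenceApproximable)
    (hL : ∀ (m : ℕ) (ρ : SurfaceGroup (3 + 3 * m) ≃* SurfaceGroup (3 + 3 * m)),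
      (∀ M : Subgroup (SurfaceGroup (3 + 3 * m)), M.Characteristic → M.FiniteIndex →
        ∃ x c : SurfaceGroup (3 + 3 * m) ≃* SurfaceGroup (3 + 3 * m),
          (s4Kernels.stabilizeIter m 0).map x.toMonoidHom = s4Kernels.stabilizeIter m 0 ∧
          (s4Kernels.stabilizeIter m 1).map x.toMonoidHom = s4Kernels.stabilizeIter m 1 ∧
          (s4Kernels.stabilizeIter m 2).map c.toMonoidHom = s4Kernels.stabilizeIter m 2 ∧
          ∀ s, ρ s * (x (c s))⁻¹ ∈ M) →
      s4Kernels.stabilizeIter m 0 ⊔ s4Kernels.stabilizeIter m 1 ⊔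
        (s4Kernels.stabilizeIter m 2).map ρ.toMonoidHom = ⊤ →
      ∃ x c : SurfaceGroup (3 + 3 * m) ≃* SurfaceGroup (3 + 3 * m),
        (s4Kernels.stabilizeIter m 0).map x.toMonoidHom = s4Kernels.stabilizeIter m 0 ∧
        (s4Kernels.stabilizeIter m 1).map x.toMonoidHom = s4Kernels.stabilizeIter m 1 ∧
        (s4Kernels.stabilizeIter m 2).map c.toMonoidHom = s4Kernels.stabilizeIter m 2 ∧ ∀ s, ρ s = x (c s)) :
    ShadowApproximation := by
  intro m K hK hnorm hsh
  obtain ⟨α, ρ, h0, h1, h2, hlev⟩ := hCA m K hK hnorm hsh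
  -- `ρ` lies on the locus: `α (N₀ ⊔ N₁ ⊔ ρN₂) = K₀ ⊔ K₁ ⊔ K₂ = ⊤`
  have htop : s4Kernels.stabilizeIter m 0 ⊔ s4Kernels.stabilizeIter m 1 ⊔
      (s4Kernels.stabilizeIter m 2).map ρ.toMonoidHom = ⊤ := by
    have hmap : (s4Kernels.stabilizeIter m 0 ⊔ s4Kernels.stabilizeIter m 1 ⊔
        (s4Kernels.stabilizeIter m 2).map ρ.toMonoidHom).map α.toMonoidHom = ⊤ := by
      rw [Subgroup.map_sup, Subgroup.map_sup, h0, h1, h2]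
      exact sup_eq_top_of_isGroupTrisection_punit hK
    have := congr_arg (Subgroup.map α.symm.toMonoidHom) hmap
    rw [Subgroup.map_map] at this
    have hid : α.symm.toMonoidHom.comp α.toMonoidHom = MonoidHom.id _ := MonoidHom.ext fun s => by simp
    rw [hid, Subgroup.map_id] at this
    rw [this, ← MonoidHom.range_eq_map, MonoidHom.range_eq_top]
    exact α.symm.surjective
  obtain ⟨x, c, hx0, hx1, hc2, hρ⟩ := hL m ρ hlev htop
  have htrans : (x.trans α).toMonoidHom = α.toMonoidHom.comp x.toMonoidHom :=
    MonoidHom.ext fun _ => rfl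
  have hρ' : ρ.toMonoidHom = x.toMonoidHom.comp c.toMonoidHom := MonoidHom.ext hρ
  have hx2 : (s4Kernels.stabilizeIter m 2).map x.toMonoidHom =
      (s4Kernels.stabilizeIter m 2).map ρ.toMonoidHom := by
    rw [hρ', ← Subgroup.map_map, hc2]
  refine ⟨x.trans α, fun i => ?_⟩
  rw [htrans, ← Subgroup.map_map]
  fin_cases i
  · show ((s4Kernels.stabilizeIter m 0).map x.toMonoidHom).map α.toMonoidHom = K 0
    rw [hx0, h0]
  · show ((s4Kernels.stabilizeIter m 1).map x.toMonoidHom).map α.toMonoidHom = K 1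
    rw [hx1, h1]
  · show ((s4Kernels.stabilizeIter m 2).map x.toMonoidHom).map α.toMonoidHom = K 2
    rw [hx2, h2]

/-! ## Registered stubs (signatures verbatim as registered on stmt-SmoothPoincare4-14596) -/

/-- **Registered stub `stub_hhccIffLocusAndLimitsSimplyConnected` of line `pair-rigidity-retraction`:** the crux is,
unconditionally, the conjunction of its locus form and "no fine ghosts"; `= hhcc_iff_locus_and_limitsSimplyConnected`.
[folklore] -/
theorem stub_hhccIffLocusAndLimitsSimplyConnected :
    HeegaardHandlebodyCongruenceClosed ↔
      (∀ (m : ℕ) (ρ : SurfaceGroup (3 + 3 * m) ≃* SurfaceGroup (3 + 3 * m)),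
        (∀ M : Subgroup (SurfaceGroup (3 + 3 * m)), M.Characteristic → M.FiniteIndex →
          ∃ x c : SurfaceGroup (3 + 3 * m) ≃* SurfaceGroup (3 + 3 * m),
            (s4Kernels.stabilizeIter m 0).map x.toMonoidHom = s4Kernels.stabilizeIter m 0 ∧
            (s4Kernels.stabilizeIter m 1).map x.toMonoidHom = s4Kernels.stabilizeIter m 1 ∧
            (s4Kernels.stabilizeIter m 2).map c.toMonoidHom = s4Kernels.stabilizeIter m 2 ∧
            ∀ s, ρ s * (x (c s))⁻¹ ∈ M) →
        s4Kernels.stabilizeIter m 0 ⊔ s4Kernels.stabilizeIter m 1 ⊔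
          (s4Kernels.stabilizeIter m 2).map ρ.toMonoidHom = ⊤ →
        ∃ x c : SurfaceGroup (3 + 3 * m) ≃* SurfaceGroup (3 + 3 * m),
          (s4Kernels.stabilizeIter m 0).map x.toMonoidHom = s4Kernels.stabilizeIter m 0 ∧
          (s4Kernels.stabilizeIter m 1).map x.toMonoidHom = s4Kernels.stabilizeIter m 1 ∧
          (s4Kernels.stabilizeIter m 2).map c.toMonoidHom = s4Kernels.stabilizeIter m 2 ∧ ∀ s, ρ s = x (c s)) ∧
      (∀ (m : ℕ) (ρ : SurfaceGroup (3 + 3 * m) ≃* SurfaceGroup (3 + 3 * m)),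
        (∀ M : Subgroup (SurfaceGroup (3 + 3 * m)), M.Characteristic → M.FiniteIndex →
          ∃ x c : SurfaceGroup (3 + 3 * m) ≃* SurfaceGroup (3 + 3 * m),
            (s4Kernels.stabilizeIter m 0).map x.toMonoidHom = s4Kernels.stabilizeIter m 0 ∧
            (s4Kernels.stabilizeIter m 1).map x.toMonoidHom = s4Kernels.stabilizeIter m 1 ∧
            (s4Kernels.stabilizeIter m 2).map c.toMonoidHom = s4Kernels.stabilizeIter m 2 ∧
            ∀ s, ρ s * (x (c s))⁻¹ ∈ M) →
        s4Kernels.stabilizeIter m 0 ⊔ s4Kernels.stabilizeIter m 1 ⊔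
          (s4Kernels.stabilizeIter m 2).map ρ.toMonoidHom = ⊤) :=
  hhcc_iff_locus_and_limitsSimplyConnected

/-- **Registered stub `stub_artinGatesOfLocus` of line `pair-rigidity-retraction`:** `CongruenceApproximable` and the
locus form of the crux imply `ShadowApproximation`; `= shadowApproximation_of_congruenceApproximable_of_locus`.
[folklore] -/
theorem stub_artinGatesOfLocus :
    CongruenceApproximable →
      (∀ (m : ℕ) (ρ : SurfaceGroup (3 + 3 * m) ≃* SurfaceGroup (3 + 3 * m)),
        (∀ M : Subgroup (SurfaceGroup (3 + 3 * m)), M.Characteristic → M.FiniteIndex →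
          ∃ x c : SurfaceGroup (3 + 3 * m) ≃* SurfaceGroup (3 + 3 * m),
            (s4Kernels.stabilizeIter m 0).map x.toMonoidHom = s4Kernels.stabilizeIter m 0 ∧
            (s4Kernels.stabilizeIter m 1).map x.toMonoidHom = s4Kernels.stabilizeIter m 1 ∧
            (s4Kernels.stabilizeIter m 2).map c.toMonoidHom = s4Kernels.stabilizeIter m 2 ∧
            ∀ s, ρ s * (x (c s))⁻¹ ∈ M) →
        s4Kernels.stabilizeIter m 0 ⊔ s4Kernels.stabilizeIter m 1 ⊔
          (s4Kernels.stabilizeIter m 2).map ρ.toMonoidHom = ⊤ →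
        ∃ x c : SurfaceGroup (3 + 3 * m) ≃* SurfaceGroup (3 + 3 * m),
          (s4Kernels.stabilizeIter m 0).map x.toMonoidHom = s4Kernels.stabilizeIter m 0 ∧
          (s4Kernels.stabilizeIter m 1).map x.toMonoidHom = s4Kernels.stabilizeIter m 1 ∧
          (s4Kernels.stabilizeIter m 2).map c.toMonoidHom = s4Kernels.stabilizeIter m 2 ∧ ∀ s, ρ s = x (c s)) →
      ShadowApproximation :=
  fun hCA hL => shadowApproximation_of_congruenceApproximable_of_locus hCA hL

end Summit.SmoothPoincare4.SmoothPoincare4.Theorems.HeegaardHandlebodyCongruenceClosed.PairRigidityRetraction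

end
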